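import Literature.NumberTheory.EllipticCurves.Selmer
import Literature.NumberTheory.EllipticCurves.QuadraticTwist
import HarnessLib

/-!
# Lowering the `2`-Selmer rank by two with a prime quadratic twist (Mazur–Rubin 2010, Prop. 5.2)

Topic `Literature/NumberTheory/EllipticCurves/MazurRubin2010` (the tree's directory for this paper, next to
`TwistSelmerRankControl.lean` = Prop. 3.3 / Cor. 3.4 (ii) / Lemma 2.10 over `ℚ` and `SelmerRankComparison.lean`),
namespace `Literature.NumberTheory.EllipticCurves.MazurRubin2010`; naming as there (`prop33_rat`, `cor34ii_rat`).
ONE named fact (statement only, not proved here), in the tree's vocabulary (`WeierstrassCurve.selmerGroup`, file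
`Selmer`; `WeierstrassCurve.quadraticTwist`, file `QuadraticTwist`). Typed by prover seat bsd-line-gk2-p5 (cell
`bsd-f1-sign2`, 2026-08-28) for crux 22136 of route `GenusKolyvaginAtTwo` (consumer:
`Summits/…/Theorems/GenusKolyvaginAtTwoGenusPrimitiveSupplyAtTwoTwinSupply.lean`, where it is the binder `hMR`).

Source: B. Mazur, K. Rubin, *Ranks of twists of elliptic curves and Hilbert's tenth problem*, Invent. Math. 181
(2010), 541–575 [MazurRubin2010] (held: `paper:anon2010-ranks-twists-elliptic-curves-hilberts-tenth-problem`, the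
DASH preprint, whose pagination is quoted). Notation of the source: `K` a number field, `E/K` an elliptic curve,
`Sel₂(E/K) ⊂ H¹(K, E[2])` the `2`-Selmer group (§2), `d₂(E/K) := dim_{𝔽₂} Sel₂(E/K)`, `E^F` the quadratic twist of
`E` by a quadratic extension `F/K`.

**Proposition 5.2** (p. 14), as printed: «Suppose `E/K` is an elliptic curve such that `E(K)[2] = 0`. If
`d₂(E/K) > 1`, then `E` has a quadratic twist `E^F` over `K` such that `d₂(E^F/K) = d₂(E/K) − 2`.»

Its PROOF (p. 14) constructs `F` explicitly: with `M := K(E[2])`, Lemma 3.6 (p. 10; uses `E(K)[2] = 0`) gives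
`γ ∈ G_K` with `γ|_{M K^{ab}} = 1` on which two independent Selmer cocycles evaluate to a basis of `E[2]`; `N` is «a
Galois extension of `K` containing `M K(8Δ∞)`, large enough so that the restriction of `Sel₂(E/K)` to `N` is zero»;
«Let `𝔭` be a prime of `K` where `E` has good reduction, not dividing `2`, whose Frobenius in `Gal(N/K)` is the
conjugacy class of `γ`. Then `𝔭` has a totally positive generator `π ≡ 1 (mod 8Δ)`. Let `F = K(√π)`. … Corollary
3.4(i) now yields `d₂(E^F/K) = d₂(E/K) − 2`.» Since `γ` is trivial on the maximal abelian extension `K^{ab}` and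
`N` may be taken to contain any ray class field, the Frobenius condition puts `𝔭` in the TRIVIAL class of every ray
class group: over `K = ℚ` the twisting prime `p = π > 0` can be taken `≡ 1` modulo any prescribed modulus `m`
(and there are infinitely many such `p`, by Čebotarev). This is the form recorded below (`K = ℚ`, twist by the
prime `p` itself, `#Sel₂ = 2^{d₂}`), which is what the tree's consumers need (walking the `2`-Selmer rank down
inside a prescribed local class of twists, e.g. Heegner discriminants).

* `prop52_rat` — Prop. 5.2 over `ℚ` in this proof form (transcription as in `TwistSelmerRankControl.lean`: `E/ℚ` = any
  model `W` with `[W.IsElliptic]`; «`E(ℚ)[2] = 0`» = `Nat.card E(ℚ)[2] = 1`; «`d₂ = s`» = `#Sel₂ = 2^s` for the tree's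
  `WeierstrassCurve.selmerGroup 2`, a finite elementary abelian `2`-group; `E^F`, `F = ℚ(√p)`, = the model
  `W.quadraticTwist p`, `d₂` being model-independent).

NOT here: the number-field statement (`F = K(√π)`, `𝔭^h = (π)`); the counting versions («`E` has many twists»,
Thm. 1.4 / Thm. 1.7: `N_r(E, X) ≫ X/(log X)^{2/3}`); the companion steps Prop. 5.1 (`d₂ ± 1` under the hypotheses
of Thm. 1.6) and Prop. 5.3 (parity change); the conclusion that `p` is a prime of good reduction (recoverable by
taking `m` divisible by the conductor). -- TODO(general form): `K` a number field, `F = K(√π)` with `π` a totally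
positive generator of an odd power of a good prime `𝔭 ∤ 2`, `π ≡ 1` modulo any modulus, `d₂(E^F/K) = d₂(E/K) − 2`.

## References

* [MazurRubin2010] B. Mazur, K. Rubin, *Ranks of twists of elliptic curves and Hilbert's tenth problem*, Invent.
  Math. 181 (2010), 541–575: Prop. 5.2 and its proof (preprint p. 14), Lemma 3.6 (p. 10), Cor. 3.4 (p. 9).
* [SilvermanAEC2009] J. H. Silverman, *The Arithmetic of Elliptic Curves*, 2nd ed., X.§4 (the `n`-Selmer group).
-/

noncomputable section

open scoped AddSubgroup

namespace Literature.NumberTheory.EllipticCurves.MazurRubin2010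

/-- **Mazur–Rubin 2010, Prop. 5.2, over `ℚ`, in the form its proof gives.** Let `E/ℚ` be an elliptic curve (any
Weierstrass model `W`) with `E(ℚ)[2] = 0` and `2`-Selmer rank `d₂(E/ℚ) = s > 1` (`#Sel₂(E/ℚ) = 2^s`). Then for every
modulus `m ≠ 0` there is a prime `p ≡ 1 (mod m)` such that the quadratic twist `E^{(p)}` (by `F = ℚ(√p)`) has
`d₂(E^{(p)}/ℚ) = s − 2`, i.e. `#Sel₂(E^{(p)}/ℚ) = 2^{s−2}`. Printed statement: «Suppose `E/K` is an elliptic curve such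
that `E(K)[2] = 0`. If `d₂(E/K) > 1`, then `E` has a quadratic twist `E^F` over `K` such that
`d₂(E^F/K) = d₂(E/K) − 2`»; the proof takes `F = K(√π)`, `π ≡ 1 (mod 8Δ)` a totally positive generator of a good
prime `𝔭 ∤ 2` whose Frobenius is a prescribed `γ` with `γ|_{M K^{ab}} = 1` (Lemma 3.6), so `𝔭` lies in the trivial
ray class modulo any modulus — over `ℚ`: `π = p ≡ 1 (mod m)` for any `m`. Special case `K = ℚ` of the source; named
fact (PUBLISHED), nothing asserted: users take `(h : prop52_rat)`.
[cite: MazurRubin2010, Prop. 5.2 (and its proof, p. 14) with Lemma 3.6 (p. 10)] -/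
def prop52_rat : Prop :=
  ∀ (W : WeierstrassCurve ℚ) [W.IsElliptic],
    Nat.card (W.toAffine.Point[((2 : ℕ) : ℤ)]) = 1 →
    ∀ s : ℕ, Nat.card (W.selmerGroup 2) = 2 ^ s → 1 < s →
    ∀ m : ℕ, m ≠ 0 →
      ∃ p : ℕ, p.Prime ∧ (p : ℤ) ≡ 1 [ZMOD (m : ℤ)] ∧
        Nat.card ((W.quadraticTwist (p : ℚ)).selmerGroup 2) = 2 ^ (s - 2)

end Literature.NumberTheory.EllipticCurves.MazurRubin2010

end
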